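import Literature.MathematicalPhysics.QuantumFieldTheory.Balaban1983to89.B5Hk163Qk
import Literature.MathematicalPhysics.QuantumFieldTheory.Balaban1983to89.B5Hk163Decay
import Literature.MathematicalPhysics.QuantumFieldTheory.Balaban1983to89.B5Block118
import Literature.MathematicalPhysics.QuantumFieldTheory.Balaban1983to89.B5Kernel166Decay
import Literature.MathematicalPhysics.QuantumFieldTheory.Balaban1983to89.B5Constraint130

/-!
# `Balaban1983to89.B5Hk163Torus` — (1.63) AS A TYPED TORUS OPERATOR `H_k`: `Q_kH_k = I` as an identity of
typed operators, and the kernel of `H_k` = the torus kernel of the fine-offset multipliers `G_a` (exponential decay)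
(cell GAPS G-b05g10-4, node X10; successor of `B5Hk163Qk`, `B5Hk163Decay`, `B5Block118`)

T. Bałaban, *Propagators and renormalization transformations for lattice gauge theories. I*, Commun. Math. Phys.
**95**, 17–40 (1984) [`Balaban1984PropagatorsI`, cell paper B5].  PRINTED TEXT (locations only; renders
`…rt-I-p011-x2.png`, `…-p012-x2.png`, `…-p013-x2.png` (pp. 27–29) read as images by the author of this file; v1.0.1 = DOCSTRING-ONLY
correction of v1's two mis-attributed quotations, code byte-identical):

* (1.63) p. 28 [PDF 12] is a MOMENTUM display: «We have the following momentum representation for H_kB :» followed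
  by `(H̃_kB)_μ(p′+l) = … B̃_λ(p′)` (1.63) (the display is typed in `B5Symbol163`; its second printed expression is
  `B5Symbol163.second163`, on the zero-free strip `= Σ_λ h163 μ λ l (p′)·B̃_λ`, `B5Hk163Strip.second163_eq_sum_h163`),
  and then «This expression is well defined and bounded for all values of l and p′, including p′ = 0 where it is
  defined as a limit for p′ → 0.»  The POSITION-SPACE form used below — `(H_kB)_μ(x′)` = inverse fine-lattice
  Fourier transform of `(H̃_kB)_μ(p′+l)`, i.e. `(2π)^{−d}∫dp′ Σ_l e^{i(p′+l)x′}(…)` on the infinite lattice and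
  `|T₁|⁻¹Σ_{p′}Σ_l e^{i(p′+l)x′}(…)` on the torus, momenta `q = p′ + l` as in (1.61) — is OUR reading (Fourier
  conventions and normalisations ours), not a printed display;
* p. 29 [PDF 13], after (1.63): «Using (1.60), or better (1.63), we can verify all the properties of H_kB:
  Q_kH_kB = B, R∂*H_kB = 0, …»;
* p. 29: «We will need also a representation of H_k similar to the representation (1.44) of the projection R. It
  will be expressed in terms of well-defined bounded operators.»; the decay METHOD p. 38 [PDF 22] «… and the
  analyticity method of proving an exponential decay (see the proof of Lemma 2.4 in [2])».

Nothing printed enters as a hypothesis (ABSOLUTE RULE); every `[cite: …]` tag is a TEXT LOCATION; the mathematics is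
`[folklore]` Fourier bookkeeping on finite tori.

## Content (sorry-free)

The torus model of the whole b05 lineage: coarse torus `T₁ = Π_ν ℤ/M_ν` (`B5Prop11Plancherel.Tor M`), fine torus
`T_η = Π_ν ℤ/(nM_ν)` (`Tor (fine n M)`, `η = 1/n`, `n = L^k`), fine point of the block of `y′` with offset `a`
= `B5Block118.bpt n M y′ a = n·y′ + a`, fine momentum `p′ + l` = `B5Block118.pOf n M (l, p′)`, torus momentum
`p′ = sOf M q ∈ (−π, π]^d`.

* §1 THE ZERO MODE.  `h163_zero_mode`: the continued multiplier of `B5Hk163Strip` at `p′ = 0`, `l = 0` is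
  `h_{0;μλ}(0) = δ_{μλ}` (the value the printed «defined as a limit for p′ → 0» prescribes: `h163` is holomorphic
  through `p′ = 0`, and at
  `p′ = l = 0` one has `Y_μ(0) = 1`, `ū = v̄_μ = ρ_0 = 1`, `∂_μ(0) = 0`); hence **`qk_h163_torus`**: for EVERY torus
  momentum `q` (including `q = 0`) `Σ_{l ∈ 2π{0..n−1}^d} u(p′+l) v_μ(p′+l) h_{l;μλ}(p′) = δ_{μλ}` (`q ≠ 0`:
  `B5Hk163Qk.qk_h163`; `q = 0`: `B5Block118.uSym_sOf_zero`, `u(l) = [l = 0]`).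
* §2 THE TYPED OPERATOR.  `HkOp n M : Matrix (Tor (fine n M) × Fin d) (Tor M × Fin d) ℂ`, the fine 1-form
  `(H_kB)_μ(x′) = Σ_{y,λ} hker μ λ x′ y · B_λ(y)` with the kernel
  `hker μ λ x′ y := |T₁|⁻¹ Σ_{p′} Σ_l e^{i(p′+l)·x′} e^{−ip′·y} h_{l;μλ}(p′)` = our position-space torus reading
  of the (1.63) multiplier (`HkOp_mulVec_eq_163` displays `(H_kB)_μ(x′) = |T₁|⁻¹ Σ_{p′,l} e^{i(p′+l)x′} Σ_λ h·B̃_λ(p′)`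
  with `B̃_λ(p′) = Σ_y e^{−ip′y}B_λ(y)` = `tildeB`, normalisation ours).  `dft_HkOp`: its momentum representation for
  the unitary DFT pair of `B5Prop11Plancherel` — `(H_kB)^_μ(p′+l) = c⁻¹ Σ_λ h_{l;μλ}(p′) B̂_λ(p′)`,
  `c = B5Block118.cQ = (√(n^d))⁻¹` (the constant of `B5Block118.dft_QvOp`, (1.61)) — this IS the shape of the printed
  momentum display (1.63) `(H̃_kB)_μ(p′+l) = Σ_λ[…]B̃_λ(p′)` with its bracket resolved as `h_{l;μλ}(p′)`, up to our
  normalisation `c⁻¹`.  **`QvOp_HkOp_mulVec`: `Q_k(H_kB) = B` for every `B`** and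
  **`QvOp_mul_HkOp`: `QvOp n M * HkOp n M = 1`** — the first p. 29 property as an identity of the typed torus
  operators `B5Block118.QvOp` ((1.18)) and `HkOp` ((1.63)), from `dft_QvOp` ((1.61)), `dft_HkOp`, §1 and the
  injectivity of the unitary DFT.
* §3 THE KERNEL DICTIONARY AND ITS DECAY (dimension written `d + 1 ≥ 1` as in the engine `B4TorusKernel`).
  `hker_bpt`: the kernel from the coarse point `y` to the fine point `n·y′ + a` depends on `y′ − y` only and equals
  `gker a (y′ − y) = |T₁|⁻¹ Σ_{p′} e^{ip′(y′−y)} G_a(p′)` with `G_a = B5Hk163Decay.G163 n μ λ a` (the fine-offset phase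
  `e^{i(p′+l)·ηa}` is `B5Hk163Decay.phase163`, `phase163_sOf`); `gker_toT_eq_torusKernel`: `gker a (x̄)` IS
  `B4TorusKernel.MultiPeriod.torusKernel (descendC G_a) M x` (the face flip `−π ↔ π` of the two momentum conventions is
  absorbed by `face_match` + `B5Hk163Decay.stripRegular_G163`, as in `B5Kernel166Decay.ksum_toT_eq_torusKernel`);
  hence **`norm_HkOp_le`**: `|H_k((n·y′+a, μ), (y, λ))| ≤ MG163(d+1)·periodConst(κ₁₆₃(d+1), d)·e^{−(κ₁₆₃(d+1)/(d+1))|y′−y|_{T,∞}}`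
  for every period vector `M`, every `n ≥ 1`, all `μ, λ, a` — constants depending on the dimension only
  (`B5Hk163Decay.torusKernel_G163_decay` BY NAME).

## Honest scope

(i) TORUS MODEL ONLY (finite periodic lattices, as everywhere in the b05 lineage); the infinite-lattice `(2π)^{−d}∫dp′`
version of (1.63) is not typed here (its kernel decay is `B5Hk163Decay.latticeKernel_G163_decay`).  (ii) Only the FIRST
p. 29 property `Q_kH_k = I` is certified for the typed operator; `R∂*H_kB = 0` and the minimisation property are NOT
claimed (they are certified in the (1.60) branch as operator logic by `B5HkProperties`).  (iii) The decay statement is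
for the kernel entries at lattice representatives `x′ − x` measured in the torus sup-metric `torusSupNorm`; constants
`MG163`, `κ₁₆₃`, `periodConst` are ours, crude, dimension-only — never Bałaban's `O(1)`, `δ₀`.  (iv) `U = 1`, `m² = 0`.
Value = kernel certificate of bookkeeping, NOT summit progress, NOT continuum, NOT Clay.
-/

open scoped BigOperators Matrix ComplexConjugate
open Finset Complex

namespace Literature.MathematicalPhysics.QuantumFieldTheory.Balaban1983to89.B5Hk163Torus

open Literature.MathematicalPhysics.QuantumFieldTheory.Balaban1983to89.B4Strip (ofRealVec shift shiftr DeltaXi Sxi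
  U uFactor)
open Literature.MathematicalPhysics.QuantumFieldTheory.Balaban1983to89.B4ContourShift (BZ StripRegular)
open Literature.MathematicalPhysics.QuantumFieldTheory.Balaban1983to89.B4TorusKernel (descendC descendC_apply
  face_match rep_mem periodConst)
open Literature.MathematicalPhysics.QuantumFieldTheory.Balaban1983to89.B4TorusKernel.MultiPeriod (gridPt torusSum
  torusKernel torusSupNorm)
open Literature.MathematicalPhysics.QuantumFieldTheory.Balaban1983to89.B5Prop11Plancherel (Tor chi dft fine sOf
  conj_chi chi_add_right abs_sOf_le sOf_ne_zero sOf_zero dft_mem_unitaryGroup)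
open Literature.MathematicalPhysics.QuantumFieldTheory.Balaban1983to89.B5Prop11Fiber (dSym d1Sym vSym uSym)
open Literature.MathematicalPhysics.QuantumFieldTheory.Balaban1983to89.B5Action121 (comp)
open Literature.MathematicalPhysics.QuantumFieldTheory.Balaban1983to89.B5Block118 (cT dft_apply'
  sum_conj_chi_mul_chi up iota bpt pOf pOf_injective om chi_pOf_up chi_pOf_iota uSym_sOf_zero QvOp dft_QvOp cQ)
open Literature.MathematicalPhysics.QuantumFieldTheory.Balaban1983to89.B5Symbol166 (Yc cfac Rt)
open Literature.MathematicalPhysics.QuantumFieldTheory.Balaban1983to89.B5Constraint130 (cQ_ne_zero)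
open Literature.MathematicalPhysics.QuantumFieldTheory.Balaban1983to89.B5Hk163Strip (dC vCbar uCbar rho headC tailC
  gdir h163 kappa163 kappa163_pos shift_ofRealVec_apply)
open Literature.MathematicalPhysics.QuantumFieldTheory.Balaban1983to89.B5Hk163Qk (qk_h163)
open Literature.MathematicalPhysics.QuantumFieldTheory.Balaban1983to89.B5Hk163Decay (phase163 G163 MG163
  stripRegular_G163 torusKernel_G163_decay)
open Literature.MathematicalPhysics.QuantumFieldTheory.Balaban1983to89.B5Kernel166Decay (torFin card_Tor_cast
  toT_sub chi_toT_eq_mFourier two_pi_rep_grid chi_neg_comm)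
open Literature.MathematicalPhysics.QuantumFieldTheory.Balaban1983to89.B6LowerBound2153Torus (toT)
open Literature.MathematicalPhysics.QuantumFieldTheory.Balaban1983to89.B6Cov2156Torus (one_le_M)

noncomputable section

variable {d : ℕ}

/-! ## §1. The zero mode `p′ = 0` of the (1.63) multiplier; `Σ_l u v_μ h_{μλ} = δ_{μλ}` at every torus momentum -/

section ZeroMode

variable (n : ℕ) [NeZero n]

omit [NeZero n] in
/-- `ofRealVec 0 = 0`. [folklore] -/
theorem ofRealVec_zero : ofRealVec (0 : Fin d → ℝ) = 0 := by
  funext μ; simp [ofRealVec]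

omit [NeZero n] in
/-- `Δ^η(0) = 0` (massless: `S_ξ(0) = 0` in every coordinate). [folklore] -/
theorem DeltaXi_zero163 : DeltaXi n 0 (0 : Fin d → ℂ) = 0 := by
  simp [DeltaXi, Sxi]

/-- `U_0(0) = 1` (every factor is the filled value `uFactor n 0 0 = 1`). [folklore] -/
theorem U_zero163 : U n (fun _ => (0 : Fin n)) (0 : Fin d → ℂ) = 1 := by
  unfold U
  exact Finset.prod_eq_one fun ν _ => by simp [uFactor]

/-- `Y_μ(0) = c_μ(0) + Δ(0)·R̃_μ(0) = 1`. [folklore] -/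
theorem Yc_zero163 (μ : Fin d) : Yc n μ (0 : Fin d → ℂ) = 1 := by
  unfold Yc cfac
  rw [U_zero163, DeltaXi_zero163]
  simp [uFactor]

/-- `∂_μ(0 + 0) = 0` (continued leaf). [folklore] -/
theorem dC_zero163 (μ : Fin d) : dC n (fun _ => (0 : Fin n)) (0 : Fin d → ℂ) μ = 0 := by
  simp [dC, shift]

/-- `v̄_μ(0 + 0) = (1/n)Σ_{j<n} 1 = 1`. [folklore] -/
theorem vCbar_zero163 (μ : Fin d) : vCbar n (fun _ => (0 : Fin n)) (0 : Fin d → ℂ) μ = 1 := by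
  have hn : (n : ℂ) ≠ 0 := by exact_mod_cast NeZero.ne n
  simp [vCbar, shift, hn]

/-- `ū(0 + 0) = 1`. [folklore] -/
theorem uCbar_zero163 : uCbar n (fun _ => (0 : Fin n)) (0 : Fin d → ℂ) = 1 := by
  unfold uCbar
  exact Finset.prod_eq_one fun μ _ => vCbar_zero163 n μ

/-- **THE ZERO MODE OF (1.63)**: `h_{0;μλ}(0) = δ_{μλ}` — the head coefficient is `ū v̄_μ ρ_0 / Y_μ = 1` and the tail
carries the factor `∂_μ(0) = 0`.  (This is the value the printed «including p′ = 0 where it is defined as a limit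
for p′ → 0» prescribes: `h163` is holomorphic through `p′ = 0`, `B5Hk163Strip.differentiableAt_h163`.)
[cite: Balaban1984PropagatorsI, p.28, sentence after (1.63)] [folklore] -/
theorem h163_zero_mode (μ lam : Fin d) :
    h163 n μ lam (fun _ => (0 : Fin n)) (0 : Fin d → ℂ) = if lam = μ then 1 else 0 := by
  have hhead : headC n μ (fun _ => (0 : Fin n)) (0 : Fin d → ℂ) = 1 := by
    unfold headC
    rw [uCbar_zero163, vCbar_zero163, Yc_zero163]
    simp [rho]
  have htail : tailC n μ (fun _ => (0 : Fin n)) (0 : Fin d → ℂ) = 0 := by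
    unfold tailC
    rw [dC_zero163]
    simp
  rw [h163, hhead, htail, zero_mul, add_zero]

/-- at `p′ = 0`, `l = 0` the torus leaf `∂_μ` vanishes, so `v_μ = 1` (`B5Prop11Fiber.vSym`, filled value). [folklore] -/
theorem vSym_zero163 (μ : Fin d) : vSym n (fun _ => (0 : Fin n)) (0 : Fin d → ℝ) μ = 1 := by
  have h : dSym n (fun _ => (0 : Fin n)) (0 : Fin d → ℝ) μ = 0 := by simp [dSym, shiftr]
  simp [vSym, h]

/-- … and `u = Π_μ v_μ = 1`. [folklore] -/
theorem uSym_zero163 : uSym n (fun _ => (0 : Fin n)) (0 : Fin d → ℝ) = 1 := by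
  unfold uSym
  exact Finset.prod_eq_one fun μ _ => vSym_zero163 n μ

variable (M : Fin d → ℕ) [hM : ∀ μ, NeZero (M μ)]

/-- **`Σ_l u(p′+l) v_μ(p′+l) h_{l;μλ}(p′) = δ_{μλ}` AT EVERY TORUS MOMENTUM `p′ = sOf M q`**, INCLUDING `p′ = 0`:
for `q ≠ 0` this is `B5Hk163Qk.qk_h163` (`|p′_ν| ≤ π`, `p′ ≠ 0`); for `q = 0` only `l = 0` survives
(`B5Block118.uSym_sOf_zero`: `u(l) = [l = 0]`) and `v_μ(0) h_{0;μλ}(0) = δ_{μλ}` (§1).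
[cite: Balaban1984PropagatorsI, p.29 after (1.63) «Q_kH_kB = B»] [folklore] -/
theorem qk_h163_torus (q : Tor M) (μ lam : Fin d) :
    ∑ k : Fin d → Fin n, uSym n k (sOf M q) * vSym n k (sOf M q) μ * h163 n μ lam k (ofRealVec (sOf M q))
      = if μ = lam then 1 else 0 := by
  have hn : 1 ≤ n := Nat.one_le_iff_ne_zero.mpr (NeZero.ne n)
  by_cases hq : q = 0
  · subst hq
    rw [sOf_zero, ofRealVec_zero]
    rw [Finset.sum_eq_single (fun _ => (0 : Fin n))]
    · rw [uSym_zero163, vSym_zero163, h163_zero_mode, one_mul, one_mul]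
      by_cases h : μ = lam
      · subst h; simp
      · rw [if_neg (Ne.symm h), if_neg h]
    · intro k _ hk
      have hk' : k ≠ 0 := fun h => hk (h.trans rfl)
      have hu := uSym_sOf_zero n M k
      rw [sOf_zero, if_neg hk'] at hu
      rw [hu, zero_mul, zero_mul]
    · intro h
      exact absurd (Finset.mem_univ _) h
  · obtain ⟨ν₀, hν₀⟩ := Function.ne_iff.mp (sOf_ne_zero M hq)
    exact qk_h163 n hn (sOf M q) (abs_sOf_le M q) ν₀ hν₀ μ lam

end ZeroMode

/-! ## §2. The typed torus operator `H_k` of (1.63), its momentum representation, and `Q_kH_k = I` -/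

section Operator

variable (n : ℕ) [NeZero n] (M : Fin d → ℕ) [hM : ∀ μ, NeZero (M μ)]

/-- THE POSITION-SPACE TORUS KERNEL OF THE (1.63) MULTIPLIER (our inverse-DFT reading of the printed momentum
display): `hker μ λ x′ y = |T₁|⁻¹ Σ_{(l,p′)} e^{i(p′+l)·x′} e^{−ip′·y} h_{l;μλ}(p′)` (fine point `x′ ∈ T_η`, coarse
point `y ∈ T₁`).
[cite: Balaban1984PropagatorsI, (1.63) p.28 (momentum display; position-space torus reading and normalisation ours)] [folklore] -/
def hker (μ lam : Fin d) (x : Tor (fine n M)) (y : Tor M) : ℂ :=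
  ((Fintype.card (Tor M) : ℂ))⁻¹ *
    ∑ kq : (Fin d → Fin n) × Tor M,
      chi (fine n M) (pOf n M kq) x * conj (chi M kq.2 y) * h163 n μ lam kq.1 (ofRealVec (sOf M kq.2))

/-- **THE TYPED OPERATOR `H_k`** from unit-lattice (coarse) 1-forms `B : T₁ × {1..d} → ℂ` to fine-lattice 1-forms
`T_η × {1..d} → ℂ`, as a matrix: `H_k((x′, μ), (y, λ)) = hker μ λ x′ y`.
[cite: Balaban1984PropagatorsI, (1.63) p.28 (momentum display); p.29 «We will need also a representation of H_k similar to the representation (1.44) of the projection R. It will be expressed in terms of well-defined bounded operators.»] [folklore] -/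
def HkOp : Matrix (Tor (fine n M) × Fin d) (Tor M × Fin d) ℂ :=
  fun i b => hker n M i.2 b.2 i.1 b.1

/-- `(H_kB)_μ(x′) = Σ_y Σ_λ hker μ λ x′ y · B_λ(y)`. [folklore] -/
theorem HkOp_mulVec (B : Tor M × Fin d → ℂ) (x : Tor (fine n M)) (μ : Fin d) :
    (HkOp n M *ᵥ B) (x, μ) = ∑ y : Tor M, ∑ lam : Fin d, hker n M μ lam x y * B (y, lam) := by
  simp only [Matrix.mulVec, dotProduct, HkOp]
  rw [Fintype.sum_prod_type]

/-- the un-normalised unit-lattice transform `B̃_λ(p′) = Σ_y e^{−ip′·y} B_λ(y)` (our normalisation of the `B̃` of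
(1.63)). [folklore] -/
def tildeB (B : Tor M × Fin d → ℂ) (lam : Fin d) (q : Tor M) : ℂ := ∑ y, conj (chi M q y) * B (y, lam)

omit [NeZero n] in
/-- reordering of a triple finite sum. [folklore] -/
theorem sum_swap3 (F : Tor M → Fin d → ((Fin d → Fin n) × Tor M) → ℂ) :
    ∑ y, ∑ lam, ∑ kq, F y lam kq = ∑ kq, ∑ lam, ∑ y, F y lam kq := by
  rw [Finset.sum_comm]
  exact (Finset.sum_congr rfl fun lam _ => Finset.sum_comm).trans Finset.sum_comm

/-- **THE POSITION-SPACE FORM ON THE TORUS**: `(H_kB)_μ(x′) = |T₁|⁻¹ Σ_{p′} Σ_l e^{i(p′+l)·x′} Σ_λ h_{l;μλ}(p′) B̃_λ(p′)`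
— the inverse fine-lattice transform (momenta `q = p′ + l`) of the momentum display `(H̃_kB)_μ(p′+l) = Σ_λ[…]B̃_λ(p′)`
with the bracket resolved as `h_{l;μλ}(p′)`; reading and normalisation ours.
[cite: Balaban1984PropagatorsI, (1.63) p.28 (momentum display)] [folklore] -/
theorem HkOp_mulVec_eq_163 (B : Tor M × Fin d → ℂ) (x : Tor (fine n M)) (μ : Fin d) :
    (HkOp n M *ᵥ B) (x, μ) = ((Fintype.card (Tor M) : ℂ))⁻¹ * ∑ kq : (Fin d → Fin n) × Tor M,
        chi (fine n M) (pOf n M kq) x *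
          ∑ lam, h163 n μ lam kq.1 (ofRealVec (sOf M kq.2)) * tildeB M B lam kq.2 := by
  rw [HkOp_mulVec]
  simp only [hker, tildeB, Finset.mul_sum, Finset.sum_mul]
  rw [sum_swap3]
  refine Finset.sum_congr rfl fun kq _ => Finset.sum_congr rfl fun lam _ => Finset.sum_congr rfl fun y _ => ?_
  ring

/-- character orthogonality on `T_η` in the coset parametrisation `p = p′ + l` (`pOf` is injective):
`Σ_{x′} conj(e^{i p_{(l,p′)}·x′}) e^{i p_{(l′,p″)}·x′} = |T_η| [(l′,p″) = (l,p′)]`. [folklore] -/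
theorem sum_conj_chi_pOf (k : Fin d → Fin n) (q : Tor M) (kq : (Fin d → Fin n) × Tor M) :
    ∑ x, conj (chi (fine n M) (pOf n M (k, q)) x) * chi (fine n M) (pOf n M kq) x
      = if kq = (k, q) then (Fintype.card (Tor (fine n M)) : ℂ) else 0 := by
  rw [sum_conj_chi_mul_chi]
  by_cases h : kq = (k, q)
  · rw [if_pos h, if_pos (by rw [h])]
  · rw [if_neg h, if_neg (fun e => h (pOf_injective n M e))]

/-- the fine DFT row at `p = p′ + l` against the kernel: only the alias `(l, p′)` itself survives.
`Σ_{x′} F^η_{p,x′} hker μ λ x′ y = |T_η|^{1/2} |T₁|⁻¹ e^{−ip′·y} h_{l;μλ}(p′)`. [folklore] -/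
theorem sum_dft_mul_hker (k : Fin d → Fin n) (q : Tor M) (μ lam : Fin d) (y : Tor M) :
    ∑ x, dft (fine n M) (pOf n M (k, q)) x * hker n M μ lam x y
      = (cT (fine n M) : ℂ) * (Fintype.card (Tor (fine n M)) : ℂ) * ((Fintype.card (Tor M) : ℂ))⁻¹
        * (conj (chi M q y) * h163 n μ lam k (ofRealVec (sOf M q))) := by
  have hx : ∀ x, dft (fine n M) (pOf n M (k, q)) x * hker n M μ lam x y
      = (cT (fine n M) : ℂ) * ((Fintype.card (Tor M) : ℂ))⁻¹ *
        ∑ kq : (Fin d → Fin n) × Tor M,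
          (conj (chi M kq.2 y) * h163 n μ lam kq.1 (ofRealVec (sOf M kq.2))) *
          (conj (chi (fine n M) (pOf n M (k, q)) x) * chi (fine n M) (pOf n M kq) x) := by
    intro x
    rw [dft_apply', hker]
    simp only [Finset.mul_sum]
    refine Finset.sum_congr rfl fun kq _ => ?_
    ring
  simp_rw [hx]
  rw [← Finset.mul_sum, Finset.sum_comm]
  simp_rw [← Finset.mul_sum, sum_conj_chi_pOf, mul_ite, mul_zero]
  rw [Finset.sum_ite_eq' Finset.univ (k, q), if_pos (Finset.mem_univ _)]
  ring

/-- the constants: `|T_η|^{-1/2}·|T_η|·|T₁|⁻¹ = c⁻¹·|T₁|^{-1/2}`, `c = cQ = |T₁|^{-1/2}|T_η|^{-1/2}|T₁|`. [folklore] -/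
theorem const_eq163 : (cT (fine n M) : ℂ) * (Fintype.card (Tor (fine n M)) : ℂ) * ((Fintype.card (Tor M) : ℂ))⁻¹
    = ((cQ n M : ℂ))⁻¹ * (cT M : ℂ) := by
  have hcf : (0 : ℝ) < Fintype.card (Tor (fine n M)) := by exact_mod_cast Fintype.card_pos
  have hcM : (0 : ℝ) < Fintype.card (Tor M) := by exact_mod_cast Fintype.card_pos
  have hTf : (cT (fine n M) : ℝ) ^ 2 * Fintype.card (Tor (fine n M)) = 1 := by
    unfold cT
    rw [inv_pow, Real.sq_sqrt hcf.le, inv_mul_cancel₀ hcf.ne']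
  have hTf' : (cT (fine n M) : ℂ) ^ 2 * (Fintype.card (Tor (fine n M)) : ℂ) = 1 := by exact_mod_cast hTf
  have hcT1 : (cT M : ℂ) ≠ 0 := by
    have : (0 : ℝ) < cT M := by unfold cT; positivity
    exact_mod_cast this.ne'
  have hcTf : (cT (fine n M) : ℂ) ≠ 0 := by
    have : (0 : ℝ) < cT (fine n M) := by unfold cT; positivity
    exact_mod_cast this.ne'
  have hcMc : (Fintype.card (Tor M) : ℂ) ≠ 0 := by exact_mod_cast hcM.ne'
  have hcQ : (cQ n M : ℂ) = (cT M : ℂ) * (cT (fine n M) : ℂ) * (Fintype.card (Tor M) : ℂ) := by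
    unfold cQ; push_cast; ring
  have key : (cT (fine n M) : ℂ) * (Fintype.card (Tor (fine n M)) : ℂ) = ((cT (fine n M) : ℂ))⁻¹ := by
    calc (cT (fine n M) : ℂ) * (Fintype.card (Tor (fine n M)) : ℂ)
        = (cT (fine n M) : ℂ) * (Fintype.card (Tor (fine n M)) : ℂ)
            * ((cT (fine n M) : ℂ) * ((cT (fine n M) : ℂ))⁻¹) := by rw [mul_inv_cancel₀ hcTf, mul_one]
      _ = ((cT (fine n M) : ℂ) ^ 2 * (Fintype.card (Tor (fine n M)) : ℂ)) * ((cT (fine n M) : ℂ))⁻¹ := by ring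
      _ = ((cT (fine n M) : ℂ))⁻¹ := by rw [hTf', one_mul]
  rw [key, hcQ]
  field_simp

/-- **THE MOMENTUM REPRESENTATION OF THE TYPED `H_k`** (unitary DFT pair of `B5Prop11Plancherel`):
`(H_kB)^_μ(p′+l) = c⁻¹ · Σ_λ h_{l;μλ}(p′) · B̂_λ(p′)`, `c = cQ n M = (√(n^d))⁻¹` — the shape of the printed momentum
display (1.63) `(H̃_kB)_μ(p′+l) = Σ_λ[…]B̃_λ(p′)` with its bracket `= Σ_λ h·B̃_λ` on the zero-free zone
(`B5Hk163Strip.second163_eq_sum_h163`), up to our normalisation `c⁻¹`.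
[cite: Balaban1984PropagatorsI, (1.63) p.28 «We have the following momentum representation for H_kB :»] [folklore] -/
theorem dft_HkOp (B : Tor M × Fin d → ℂ) (k : Fin d → Fin n) (q : Tor M) (μ : Fin d) :
    (dft (fine n M) *ᵥ comp (fine n M) (HkOp n M *ᵥ B) μ) (pOf n M (k, q))
      = ((cQ n M : ℂ))⁻¹ * ∑ lam, h163 n μ lam k (ofRealVec (sOf M q)) * (dft M *ᵥ comp M B lam) q := by
  have hc : comp (fine n M) (HkOp n M *ᵥ B) μ = fun x => ∑ y, ∑ lam, hker n M μ lam x y * B (y, lam) := by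
    funext x; exact HkOp_mulVec n M B x μ
  have hL : (dft (fine n M) *ᵥ comp (fine n M) (HkOp n M *ᵥ B) μ) (pOf n M (k, q))
      = ∑ y, ∑ lam, B (y, lam) * ∑ x, dft (fine n M) (pOf n M (k, q)) x * hker n M μ lam x y := by
    rw [hc]
    simp only [Matrix.mulVec, dotProduct]
    simp_rw [Finset.mul_sum]
    rw [Finset.sum_comm]
    refine Finset.sum_congr rfl fun y _ => ?_
    rw [Finset.sum_comm]
    refine Finset.sum_congr rfl fun lam _ => Finset.sum_congr rfl fun x _ => ?_
    ring
  rw [hL]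
  simp_rw [sum_dft_mul_hker, const_eq163]
  simp only [Matrix.mulVec, dotProduct, comp, dft_apply']
  rw [Finset.sum_comm]
  simp only [Finset.mul_sum]
  refine Finset.sum_congr rfl fun lam _ => Finset.sum_congr rfl fun y _ => ?_
  ring

omit [NeZero n] in
/-- the unitary DFT is injective on functions. [folklore] -/
theorem dft_mulVec_injective : Function.Injective fun f : Tor M → ℂ => dft M *ᵥ f := by
  intro f g h
  have h1 : star (dft M) * dft M = 1 := Matrix.mem_unitaryGroup_iff'.mp (dft_mem_unitaryGroup M)
  have hf : star (dft M) *ᵥ (dft M *ᵥ f) = f := by rw [Matrix.mulVec_mulVec, h1, Matrix.one_mulVec]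
  have hg : star (dft M) *ᵥ (dft M *ᵥ g) = g := by rw [Matrix.mulVec_mulVec, h1, Matrix.one_mulVec]
  have h' : dft M *ᵥ f = dft M *ᵥ g := h
  rw [← hf, ← hg, h']

/-- **`Q_k H_k B = B` FOR THE TYPED TORUS OPERATORS** `Q_k = B5Block118.QvOp` ((1.18), momentum representation (1.61)
= `dft_QvOp`) and `H_k = HkOp` ((1.63)): in momentum space `(Q_kH_kB)^_μ(p′) = c Σ_l u v_μ · c⁻¹ Σ_λ h_{l;μλ} B̂_λ
= Σ_λ [Σ_l u v_μ h_{l;μλ}] B̂_λ = B̂_μ(p′)` by `qk_h163_torus`, at EVERY `p′` (the zero mode included), and the unitary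
DFT is injective. [cite: Balaban1984PropagatorsI, p.29 after (1.63) «we can verify all the properties of H_kB: Q_kH_kB = B»] [folklore] -/
theorem QvOp_HkOp_mulVec (B : Tor M × Fin d → ℂ) : QvOp n M *ᵥ (HkOp n M *ᵥ B) = B := by
  have hcQ := cQ_ne_zero n M
  have key : ∀ μ, comp M (QvOp n M *ᵥ (HkOp n M *ᵥ B)) μ = comp M B μ := by
    intro μ
    apply dft_mulVec_injective M
    funext q
    show (dft M *ᵥ comp M (QvOp n M *ᵥ (HkOp n M *ᵥ B)) μ) q = (dft M *ᵥ comp M B μ) q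
    rw [dft_QvOp]
    have hterm : ∀ k : Fin d → Fin n,
        uSym n k (sOf M q) * vSym n k (sOf M q) μ
            * (dft (fine n M) *ᵥ comp (fine n M) (HkOp n M *ᵥ B) μ) (pOf n M (k, q))
          = ((cQ n M : ℂ))⁻¹ * ∑ lam, (uSym n k (sOf M q) * vSym n k (sOf M q) μ
              * h163 n μ lam k (ofRealVec (sOf M q))) * (dft M *ᵥ comp M B lam) q := by
      intro k
      rw [dft_HkOp]
      simp only [Finset.mul_sum]
      refine Finset.sum_congr rfl fun lam _ => ?_
      ring
    simp_rw [hterm]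
    rw [← Finset.mul_sum, ← mul_assoc, mul_inv_cancel₀ hcQ, one_mul, Finset.sum_comm]
    simp_rw [← Finset.sum_mul, qk_h163_torus n M q μ]
    simp only [ite_mul, one_mul, zero_mul, Finset.sum_ite_eq, Finset.mem_univ, if_true]
  funext b
  obtain ⟨y, μ⟩ := b
  exact congrFun (key μ) y

/-- **`Q_k H_k = I`** as a product of the typed matrices. [cite: Balaban1984PropagatorsI, p.29 «Q_kH_kB = B»] [folklore] -/
theorem QvOp_mul_HkOp : QvOp n M * HkOp n M = 1 :=
  Matrix.ext_of_mulVec_single fun i => by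
    rw [← Matrix.mulVec_mulVec, QvOp_HkOp_mulVec, Matrix.one_mulVec]

/-- the fine-offset phase of `B5Hk163Decay` at a torus momentum IS the fine character of `p′ + l` at the offset
`ηa`: `phase163 l a (p′) = e^{i(p′+l)·ηa}` (`B5Block118.chi_pOf_iota`). [folklore] -/
theorem phase163_sOf (k a : Fin d → Fin n) (q : Tor M) :
    phase163 n k a (ofRealVec (sOf M q)) = chi (fine n M) (pOf n M (k, q)) (iota n M a) := by
  rw [chi_pOf_iota, phase163]
  refine Finset.prod_congr rfl fun ν _ => ?_
  rw [shift_ofRealVec_apply, om]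
  congr 2
  simp only [Complex.ofReal_div, Complex.ofReal_natCast]

/-- THE KERNEL BETWEEN A BLOCK POINT AND A COARSE POINT as the torus momentum sum of the coarse multiplier `G_a`:
`gker a z = |T₁|⁻¹ Σ_{p′} e^{ip′·z} G_a(p′)`, `G_a = B5Hk163Decay.G163 n μ λ a`. [folklore] -/
def gker (μ lam : Fin d) (a : Fin d → Fin n) (z : Tor M) : ℂ :=
  ((Fintype.card (Tor M) : ℂ))⁻¹ * ∑ q : Tor M, chi M q z * G163 n μ lam a (ofRealVec (sOf M q))

/-- **THE DICTIONARY**: the position-space kernel from the coarse point `y` to the fine point `n·y′ + a` (`bpt y′ a`)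
is `gker a (y′ − y)` — `e^{i(p′+l)·(ny′+a)} = e^{ip′·y′}·e^{i(p′+l)·ηa}` (`chi_pOf_up`, `phase163_sOf`), so the `l`-sum
produces `G_a(p′)` (`B5Hk163Decay.exp_fine_phase_split`, torus form). [folklore] -/
theorem hker_bpt (μ lam : Fin d) (y' : Tor M) (a : Fin d → Fin n) (y : Tor M) :
    hker n M μ lam (bpt n M y' a) y = gker n M μ lam a (y' - y) := by
  unfold hker gker G163
  congr 1
  rw [Fintype.sum_prod_type, Finset.sum_comm]
  refine Finset.sum_congr rfl fun q _ => ?_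
  rw [Finset.mul_sum]
  refine Finset.sum_congr rfl fun k _ => ?_
  dsimp only
  rw [bpt, chi_add_right, chi_pOf_up, ← phase163_sOf, conj_chi, chi_neg_comm, sub_eq_add_neg, chi_add_right]
  ring

end Operator

/-! ## §3. The kernel of `H_k` is the torus kernel of `G_a`; exponential decay (dimension `d + 1 ≥ 1`) -/

section Kernel

variable (n : ℕ) [NeZero n] (M : Fin (d + 1) → ℕ) [hM : ∀ μ, NeZero (M μ)]

/-- the two momentum conventions on the grid (`2π rep(t/M) ∈ [−π,π)` of the engine versus `sOf ∈ (−π,π]`) give the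
same value of `G_a` (the face flip is absorbed by the `2π`-periodicity across the strip sides,
`B4TorusKernel.face_match` + `B5Hk163Decay.stripRegular_G163`; pattern `B5Kernel166Decay.Gsym_grid_eq`). [folklore] -/
theorem G163_grid_eq (μ lam : Fin (d + 1)) (a : Fin (d + 1) → Fin n) (t : Tor M) :
    G163 n μ lam a
        (ofRealVec (fun i => 2 * Real.pi * B4TorusKernel.rep ((((torFin M t i : ℕ) : ℝ) / M i : ℝ) : UnitAddCircle)))
      = G163 n μ lam a (ofRealVec (sOf M t)) := by
  classical
  set u : Fin (d + 1) → ℝ :=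
    fun i => 2 * Real.pi * B4TorusKernel.rep ((((torFin M t i : ℕ) : ℝ) / M i : ℝ) : UnitAddCircle) with hu_def
  have hdich : ∀ i, u i = sOf M t i ∨ (u i = -Real.pi ∧ sOf M t i = Real.pi) := fun i => two_pi_rep_grid M t i
  have hu : u ∈ BZ (d + 1) := by
    refine ⟨fun i => ?_, fun i => ?_⟩
    · have h := (rep_mem (((((torFin M t i : ℕ) : ℝ) / M i : ℝ) : UnitAddCircle))).1
      show -Real.pi ≤ 2 * Real.pi * _
      nlinarith [Real.pi_pos]
    · have h := (rep_mem (((((torFin M t i : ℕ) : ℝ) / M i : ℝ) : UnitAddCircle))).2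
      show 2 * Real.pi * _ ≤ Real.pi
      nlinarith [Real.pi_pos]
  have hv : sOf M t ∈ BZ (d + 1) :=
    ⟨fun i => (abs_le.mp (abs_sOf_le M t i)).1, fun i => (abs_le.mp (abs_sOf_le M t i)).2⟩
  refine face_match (stripRegular_G163 n (kappa163_pos _).le le_rfl μ lam a) (kappa163_pos _).le
    (Finset.univ.filter fun i => u i ≠ sOf M t i) u (sOf M t) hu hv (fun i hi => ?_) (fun i hi => ?_)
  · by_contra h
    exact hi (Finset.mem_filter.mpr ⟨Finset.mem_univ _, h⟩)
  · have h := (Finset.mem_filter.mp hi).2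
    rcases hdich i with h' | h'
    · exact absurd h' h
    · exact h'

/-- **THE KERNEL OF `H_k` IS THE TORUS KERNEL OF `G_a`**: at a lattice representative `x`,
`gker a (x̄) = B4TorusKernel.MultiPeriod.torusKernel (descendC G_a) M x` (`= Σ_m latticeKernel G_a (x + Mm)`, the
periodised `ℤ^{d+1}`-Fourier kernel, by `B4TorusKernel.MultiPeriod.torusKernel_descend_eq`). [folklore] -/
theorem gker_toT_eq_torusKernel (μ lam : Fin (d + 1)) (a : Fin (d + 1) → Fin n) (x : Fin (d + 1) → ℤ) :
    gker n M μ lam a (toT M x)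
      = torusKernel (descendC (fun p : Fin (d + 1) → ℂ => G163 n μ lam a p)
          (stripRegular_G163 n (kappa163_pos _).le le_rfl μ lam a) (kappa163_pos _).le) M x := by
  unfold gker torusKernel torusSum
  rw [card_Tor_cast]
  congr 1
  refine Fintype.sum_equiv (torFin M) _ _ fun t => ?_
  rw [descendC_apply, B4TorusKernel.MultiPeriod.descend_gridPt, chi_toT_eq_mFourier, mul_comm]
  congr 1
  exact (G163_grid_eq n M μ lam a t).symm

/-- **EXPONENTIAL DECAY OF THE KERNEL OF THE TYPED `H_k`**, uniformly in the period vector `M` (all `M_i ≥ 1`), in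
`n ≥ 1`, `μ`, `λ` and the fine offset `a`: for lattice representatives `x′, x ∈ ℤ^{d+1}`,
`|H_k((n·x̄′ + a, μ), (x̄, λ))| ≤ MG163(d+1) · periodConst(κ₁₆₃(d+1), d) · e^{−(κ₁₆₃(d+1)/(d+1)) |x′ − x|_{T,∞}}`
(`B5Hk163Decay.torusKernel_G163_decay` BY NAME; constants dimension-only, ours).
[cite: Balaban1984PropagatorsI, p.38, sentence before (1.126) «… and the analyticity method of proving an exponential decay (see the proof of Lemma 2.4 in [2]).» (location of the METHOD only; that sentence concerns ∂P∂*)] [folklore] -/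
theorem norm_HkOp_le (μ lam : Fin (d + 1)) (a : Fin (d + 1) → Fin n) (x' x : Fin (d + 1) → ℤ) :
    ‖HkOp n M (bpt n M (toT M x') a, μ) (toT M x, lam)‖
      ≤ MG163 (d + 1) * periodConst (kappa163 (d + 1)) d *
          Real.exp (-(kappa163 (d + 1) / (d + 1) * torusSupNorm M (x' - x))) := by
  show ‖hker n M μ lam (bpt n M (toT M x') a) (toT M x)‖ ≤ _
  rw [hker_bpt, toT_sub, gker_toT_eq_torusKernel]
  exact torusKernel_G163_decay n μ lam a (one_le_M M) (x' - x)

/-- consequently every fine 1-form `H_kB` is bounded pointwise by an exponentially weighted sum of `|B|`: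
`|(H_kB)_μ(n·x̄′ + a)| ≤ MG163·periodConst · Σ_{x ∈ reps} Σ_λ e^{−(κ₁₆₃/(d+1))|x′−x|_{T,∞}} |B_λ(x̄)|` for any family of
lattice representatives `r : T₁ → ℤ^{d+1}` of the coarse torus (`toT ∘ r = id`). [folklore] -/
theorem norm_HkOp_mulVec_le (B : Tor M × Fin (d + 1) → ℂ) (μ : Fin (d + 1)) (a : Fin (d + 1) → Fin n)
    (x' : Fin (d + 1) → ℤ) (r : Tor M → (Fin (d + 1) → ℤ)) (hr : ∀ y, toT M (r y) = y) :
    ‖(HkOp n M *ᵥ B) (bpt n M (toT M x') a, μ)‖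
      ≤ MG163 (d + 1) * periodConst (kappa163 (d + 1)) d *
          ∑ y : Tor M, ∑ lam : Fin (d + 1),
            Real.exp (-(kappa163 (d + 1) / (d + 1) * torusSupNorm M (x' - r y))) * ‖B (y, lam)‖ := by
  rw [HkOp_mulVec, Finset.mul_sum]
  refine (norm_sum_le _ _).trans (Finset.sum_le_sum fun y _ => ?_)
  rw [Finset.mul_sum]
  refine (norm_sum_le _ _).trans (Finset.sum_le_sum fun lam _ => ?_)
  rw [norm_mul, ← mul_assoc]
  refine mul_le_mul_of_nonneg_right ?_ (norm_nonneg _)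
  have h := norm_HkOp_le n M μ lam a x' (r y)
  rw [hr y] at h
  exact h

end Kernel

end

end Literature.MathematicalPhysics.QuantumFieldTheory.Balaban1983to89.B5Hk163Torus
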